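import Summits.BirchSwinnertonDyer.Rank1Residual.X4.KimDefectParity
import Summits.BirchSwinnertonDyer.Rank1Residual.Additive.X4SharpThreeKimConjectureEndState
import Summits.BirchSwinnertonDyer.Rank1Residual.Additive.PlusSymbolIntegrality
import HarnessLib

/-!
# The PARITY LAW for Kim's Tamagawa defect at `p ≥ 3` on TOWER rows — the N11 (`p = 3`) twin of
# `X4/KimDefectParity.lean`, CONDITIONAL on the announced Kim 2025 clause; the one-off tolerance; the
# ONE-FACTOR socket; the `ord_p ∏c ≤ 2` DICHOTOMY `BSD(E,p) ⟺ 1 ≤ ∂^{(∞)}` on unit rows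
# (cell `b2b-bsdres`, seat additive-p4 gen 19, line V36b; CLASS-CLOSURE §3.1 N11, experiment types E1/E4)

HONEST FRAMING (cell `b2b-bsdres`, run/shared/lean/b2b/bsd-rank1-residual/, verbatim in every
file): the goal of the cell is to DELETE the COMBINATION-SHAPED residual classes of the
Birch–Swinnerton-Dyer formula for ALL analytic-rank `≤ 1` elliptic curves over `ℚ` — "full BSD
formula for every rank `≤ 1` curve in class `C`" assembled STRICTLY from published theorems — so
that the rank-`≤ 1` remainder becomes exactly the CONSTRUCTION-SHAPED classes, which are TYPED
(missing-input `Prop`s), NOT attempted. This is not "finishing BSD". Sub-cell additive-p4 (X3♯/X4♯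
direct): research route on the CONSTRUCTION-SHAPED class X4; the label X4 and the marks of
RESIDUAL-MAP §I N10/N11 are UNCHANGED; nothing is booked. Theorems only (no definition, no named
fact minted). EVERY theorem below is CONDITIONAL on the ANNOUNCED statement
`Kim2025.thm11_kimShaLength_of_integralPeriod_OPEN` (C.-H. Kim, *The refined Tamagawa number
conjectures for GL₂*, arXiv:2505.09121, Thm. 1.1 — PREPRINT, flag `Kim2025-preprint`; typed by
n1011-p09, T-a4) carried as the explicit hypothesis `hK25s`: an announced preprint enters ONLY as an
explicitly labelled OPEN hypothesis, never as a theorem. The other inputs are published named facts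
as hypotheses: Cassels' theorem `hCT = exists_casselsTate_pairing`, GZK `hGZK`, modularity `hmod`;
the plus-symbol integrality on towers is p09's kernel THEOREM
(`forall_padicValRat_ratPlusSymbol_nonneg_of_towerSurj`, T-R18b), so no `hint` binder appears.

## What this file proves (all at `p ≥ 3` on rows with `ρ̄_{E,p^n}` onto for every `n`; `p = 3` is N11)

Write `d = ∂^{(∞)}(δ̃_{D.f})` (`kuriharaPartialInfty`), `c = ord_p ∏_v c_v`, `s = ord_p #Ш_an`.
* §1 PARITY LAW modulo the preprint: `d ≡ ord_p(L(E,1)/Ω(W)) (mod 2)`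
  (`even_padicValRat_sub_kimDefect_of_kim2025_OPEN_of_casselsTate`), in BSD currency `d ≡ c + s`
  (`even_padicValRat_shaAn_add_tamagawa_sub_kimDefect_…`); no `±1` failure of Conjecture 1.10 on even
  rows (`kimDefect_ne_tamagawa_add_one_and_…`). E4 use for the N11 Kurihara lanes (E2-AT3, KURREG,
  KURX@3): every row must show `∂^{(∞)} ≡ ord₃(L(E,1)/Ω_E) (mod 2)`.
* §2 ONE OFF IS ENOUGH modulo the preprint: `c ≤ d + 1 ⟹ MissingUpperBoundAt`,
  `d ≤ c + 1 ⟹ MissingLowerBoundAt`, both ⟹ `MissingPPartAt`, on even rows.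
* §3 THE ONE-FACTOR SOCKET (`p ∤ #Ш_an`, `α ≤ d`, `c ≤ α + 1` ⟹ `BSD(E,p)`) and **THE `c ≤ 2`
  DICHOTOMY** `bsdp_iff_one_le_kimDefect_of_tamagawa_le_two_of_shaAn_unit_of_kim2025_OPEN`: on a unit
  tower row with `1 ≤ c ≤ 2` — the Tamagawa-defect-one rows and the bulk of the N11 TAM-DEFECT₂♭
  residue (seat census V23: 8 ‖ 1 of the 9 ‖ 1 window rows have `ord₃ ∏_{ℓ≠3} c_ℓ = 2`; sweep 2 033)
  — **`BSD(E,p) ⟺ 1 ≤ ∂^{(∞)}`**, i.e. iff NO cyclic-level Kurihara number is a `p`-adic unit. So a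
  unit Kurihara number found on such a row REFUTES `BSD(E,3)` modulo the preprint (anomaly
  protocol), and "all Kurihara numbers divisible by `3`" — HALF of Conjecture 1.10's prediction
  `∂^{(∞)} = 2` — is exactly the missing input there. EVIDENCE pointers only; nothing booked.
* §4 OPTIMAL data (`Λ_E = c·Λ_f`, `p ∤ c`; period transfer by `X4.periodTransfer_of_optimal`).

References: C.-H. Kim, arXiv:2505.09121 (2025, PREPRINT) Thm. 1.1 [Kim2025RefinedTNC]; C.-H. Kim,
Amer. J. Math. 148 (2026) = arXiv:2203.12159v4 §1.5.1, Conj. 1.10 [Kim2022StructureSelmer];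
Cassels 1962 / Silverman *AEC* Thm. X.4.14 [SilvermanAEC2009]; Miller 2011 Def. 1.1 [Miller2011LMS];
Cremona *Algorithms* §2.8 [CremonaAlgorithms1997]; sibling `X4/KimDefectParity.lean` (published
`p ≥ 5` version); cells/n1011/OWNERS.md T-a4, T-R18b; HOME/b2b-bsdres-additive-p4/README §17–§21.
-/

noncomputable section

open scoped Classical MatrixGroups ModularForm

open Complex CongruenceSubgroup WeierstrassCurve Literature.NumberTheory.EllipticCurves
  Literature.NumberTheory.EllipticCurves.ModularForms
  Literature.NumberTheory.EllipticCurves.Rank1Residual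
  Literature.NumberTheory.EllipticCurves.Rank1Residual.Typed

namespace Summit.BirchSwinnertonDyer.Rank1Residual.Additive

/-- Parity bookkeeping in `ℤ`: if `a ≤ b + 1` and `a - b` is even then `a ≤ b`. [folklore] -/
private theorem Int.le_of_le_add_one_of_even_sub' {a b : ℤ} (h : a ≤ b + 1) (he : Even (a - b)) :
    a ≤ b := by
  rcases h.lt_or_eq with hlt | heq
  · omega
  · exfalso
    obtain ⟨k, hk⟩ := he
    omega

section PerPair

variable (W : WeierstrassCurve ℚ) [W.IsElliptic] [W.IsGloballyMinimal] (p : ℕ) [Fact p.Prime]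

/-! ### §1 The parity law at `p ≥ 3` on tower rows, CONDITIONAL on the announced clause -/

/-- **PARITY LAW at `p ≥ 3` on a tower row, CONDITIONAL on the preprint** (`hK25s`, flag
`Kim2025-preprint`): `ρ̄_{E,p^n}` onto for all `n`, `L(E,1) ≠ 0`, `Ш` finite, ANY datum `D` (any
level; the plus symbols are `p`-integral on towers by p09's theorem
`forall_padicValRat_ratPlusSymbol_nonneg_of_towerSurj`) with the period transfer, Cassels (`hCT`):
`L(E,1)/Ω(W) = q`, `∂^{(∞)}(δ̃_{D.f}) = d ∈ ℕ` and **`ord_p q − d` is EVEN**. At `p = 3` this is the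
parity every row of the N11 Kurihara lanes (E2-AT3, KURREG, KURX@3) must display.
[claim: Kim2025RefinedTNC, status: under-review]
[cite: Kim2025RefinedTNC, Thm. 1.1 ("BSD") (ANNOUNCED, OPEN binder)] [cite: SilvermanAEC2009, Thm. X.4.14]
[cite: Kim2022StructureSelmer, §1.5.1 (PDF p. 7)] -/
theorem even_padicValRat_sub_kimDefect_of_kim2025_OPEN_of_casselsTate
    (hK25s : Kim2025.thm11_kimShaLength_of_integralPeriod_OPEN)
    (hCT : exists_casselsTate_pairing (K := ℚ))
    (hp3 : 3 ≤ p) (htower : ∀ n : ℕ, W.HasSurjectiveModNGaloisRep (p ^ n : ℕ))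
    (hL : W.entireLFunction 1 ≠ 0) (hfin : Finite W.sha)
    {N : ℕ} [NeZero N] (D : ModularParametrizationData W N)
    (hper : ∃ u : ℚ, ‖(u : ℚ_[p])‖ = 1 ∧ W.realPeriodRat = u * plusPeriod D.f) :
    ∃ (q : ℚ) (d : ℕ), W.entireLFunction 1 / (W.realPeriodRat : ℂ) = (q : ℂ) ∧
      kuriharaPartialInfty W p D.f = d ∧ Even (padicValRat p q - d) := by
  have hp2 : p ≠ 2 := by omega
  obtain ⟨q, d, hq, hd, hval⟩ := kimShaLengthRankZeroAt_of_kim2025_OPEN W p hK25s hp3 htower hL hfin D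
    hper (forall_padicValRat_ratPlusSymbol_nonneg_of_towerSurj hp2 D.isNewformOf htower)
  refine ⟨q, d, hq, hd, ?_⟩
  obtain ⟨k, hk⟩ := X4.even_padicValNat_card_shaPrimary_of_casselsTate W p hCT hfin
  exact ⟨k, by rw [hval, hk, Nat.cast_add]; ring⟩

/-- **The parity law in BSD currency at `p ≥ 3` on a tower row, CONDITIONAL on the preprint**:
analytic rank `0` (modularity `hmod`), GZK (`hGZK`), tower, datum with period transfer:
`#Ш_an = q'`, `∂^{(∞)}(δ̃) = d`, **`ord_p q' + ord_p ∏_v c_v − d` EVEN** — Conjecture 1.10 can fail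
only by an even amount on the rows with `ord_p #Ш_an` even. [claim: Kim2025RefinedTNC, status: under-review]
[cite: Kim2025RefinedTNC, Thm. 1.1 ("BSD") (ANNOUNCED, OPEN binder)] [cite: SilvermanAEC2009, Thm. X.4.14]
[cite: Kim2022StructureSelmer, Conj. 1.10 (PDF p. 8)] [cite: Miller2011LMS, Def. 1.1 (arXiv:1010.2431 p. 3)] -/
theorem even_padicValRat_shaAn_add_tamagawa_sub_kimDefect_of_kim2025_OPEN_of_casselsTate
    (hK25s : Kim2025.thm11_kimShaLength_of_integralPeriod_OPEN)
    (hCT : exists_casselsTate_pairing (K := ℚ))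
    (hGZK : rank_eq_analyticRank_of_analyticRank_le_one) (hmod : hasEntireLFunction_rat)
    (hp3 : 3 ≤ p) (hr : W.analyticRank = 0) (htower : ∀ n : ℕ, W.HasSurjectiveModNGaloisRep (p ^ n : ℕ))
    {N : ℕ} [NeZero N] (D : ModularParametrizationData W N)
    (hper : ∃ u : ℚ, ‖(u : ℚ_[p])‖ = 1 ∧ W.realPeriodRat = u * plusPeriod D.f) :
    ∃ (q' : ℚ) (d : ℕ), shaAn W = (q' : ℂ) ∧ kuriharaPartialInfty W p D.f = d ∧
      Even (padicValRat p q' + padicValNat p W.tamagawaProduct - d) := by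
  have hL : W.entireLFunction 1 ≠ 0 := (W.analyticRank_eq_zero_iff_holds (hmod W)).mp hr
  obtain ⟨hmw, hfin⟩ := hGZK W (by rw [hr]; exact zero_le_one)
  have hsurj : W.HasSurjectiveModNGaloisRep p := by simpa using htower 1
  obtain ⟨q, d, hq, hd, heven⟩ := even_padicValRat_sub_kimDefect_of_kim2025_OPEN_of_casselsTate W p
    hK25s hCT hp3 htower hL hfin D hper
  obtain ⟨q', hq', hv'⟩ := X4.shaAn_of_rankZero_value W p hmw hL
    (hasIrreducibleModPGaloisRep_of_hasSurjectiveModNGaloisRep W p hsurj) hq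
  refine ⟨q', d, hq', hd, ?_⟩
  rw [hv', sub_add_cancel]
  exact heven

/-- **No `±1` failure of Conjecture 1.10 on an even tower row at `p ≥ 3`, CONDITIONAL on the
preprint**: `#Ш_an = q'`, `ord_p q'` even ⟹ `∂^{(∞)}(δ̃) ≠ ord_p ∏_v c_v + 1` and
`∂^{(∞)}(δ̃) + 1 ≠ ord_p ∏_v c_v`. E4 PREDICTION for the N11 TAM-DEFECT₂♭ unit rows at `3` with
`ord₃ ∏_v c_v = 2`: `∂^{(∞)} ∈ {0, 2}`; a Kurihara number of `3`-valuation exactly `1` on such a row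
forces `∂^{(∞)} = 0`, i.e. `¬ BSD(E,3)` modulo the preprint — report it under the anomaly protocol.
[claim: Kim2025RefinedTNC, status: under-review]
[cite: Kim2025RefinedTNC, Thm. 1.1 ("BSD") (ANNOUNCED, OPEN binder)] [cite: SilvermanAEC2009, Thm. X.4.14]
[cite: Kim2022StructureSelmer, Conj. 1.10 (PDF p. 8)] -/
theorem kimDefect_ne_tamagawa_add_one_and_of_kim2025_OPEN_of_casselsTate_of_even
    (hK25s : Kim2025.thm11_kimShaLength_of_integralPeriod_OPEN)
    (hCT : exists_casselsTate_pairing (K := ℚ))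
    (hGZK : rank_eq_analyticRank_of_analyticRank_le_one) (hmod : hasEntireLFunction_rat)
    (hp3 : 3 ≤ p) (hr : W.analyticRank = 0) (htower : ∀ n : ℕ, W.HasSurjectiveModNGaloisRep (p ^ n : ℕ))
    {N : ℕ} [NeZero N] (D : ModularParametrizationData W N)
    (hper : ∃ u : ℚ, ‖(u : ℚ_[p])‖ = 1 ∧ W.realPeriodRat = u * plusPeriod D.f)
    {q' : ℚ} (hq' : shaAn W = (q' : ℂ)) (hev : Even (padicValRat p q')) :
    kuriharaPartialInfty W p D.f ≠ (padicValNat p W.tamagawaProduct + 1 : ℕ) ∧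
      kuriharaPartialInfty W p D.f + 1 ≠ (padicValNat p W.tamagawaProduct : ℕ) := by
  obtain ⟨q'', d, hq'', hd, heven⟩ :=
    even_padicValRat_shaAn_add_tamagawa_sub_kimDefect_of_kim2025_OPEN_of_casselsTate W p hK25s hCT
      hGZK hmod hp3 hr htower D hper
  have hqq : q'' = q' := by exact_mod_cast hq''.symm.trans hq'
  subst hqq
  obtain ⟨k, hk⟩ := heven
  obtain ⟨m, hm⟩ := hev
  rw [hd]
  refine ⟨fun h => ?_, fun h => ?_⟩
  · have hdd : d = padicValNat p W.tamagawaProduct + 1 := by exact_mod_cast h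
    rw [hdd] at hk
    push_cast at hk
    omega
  · have hdd : d + 1 = padicValNat p W.tamagawaProduct := by exact_mod_cast h
    rw [← hdd] at hk
    push_cast at hk
    omega

/-! ### §2 One off is enough at `p ≥ 3` on tower rows, CONDITIONAL on the announced clause -/

/-- **UPPER half from the `≥` half relaxed by one, even tower row, `p ≥ 3`, CONDITIONAL on the
preprint**: `#Ш_an = q'`, `ord_p q'` even, `ord_p ∏_v c_v ≤ ∂^{(∞)}(δ̃) + 1` ⟹
`Typed.MissingUpperBoundAt W p`. The TAM-DEFECT₂♭ rows' missing input at `3`, weakened by one.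
[claim: Kim2025RefinedTNC, status: under-review]
[cite: Kim2025RefinedTNC, Thm. 1.1 ("BSD") (ANNOUNCED, OPEN binder)] [cite: SilvermanAEC2009, Thm. X.4.14]
[cite: Miller2011LMS, Def. 1.1] -/
theorem missingUpperBoundAt_of_tamagawa_le_kimDefect_add_one_of_even_of_kim2025_OPEN
    (hK25s : Kim2025.thm11_kimShaLength_of_integralPeriod_OPEN)
    (hCT : exists_casselsTate_pairing (K := ℚ))
    (hGZK : rank_eq_analyticRank_of_analyticRank_le_one) (hmod : hasEntireLFunction_rat)
    (hp3 : 3 ≤ p) (hr : W.analyticRank = 0) (htower : ∀ n : ℕ, W.HasSurjectiveModNGaloisRep (p ^ n : ℕ))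
    {N : ℕ} [NeZero N] (D : ModularParametrizationData W N)
    (hper : ∃ u : ℚ, ‖(u : ℚ_[p])‖ = 1 ∧ W.realPeriodRat = u * plusPeriod D.f)
    {q' : ℚ} (hq' : shaAn W = (q' : ℂ)) (hev : Even (padicValRat p q'))
    (hge : (padicValNat p W.tamagawaProduct : ℕ∞) ≤ kuriharaPartialInfty W p D.f + 1) :
    MissingUpperBoundAt W p := by
  have hp2 : p ≠ 2 := by omega
  have hint := forall_padicValRat_ratPlusSymbol_nonneg_of_towerSurj hp2 D.isNewformOf htower
  obtain ⟨q'', d, hq'', hd, heven⟩ :=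
    even_padicValRat_shaAn_add_tamagawa_sub_kimDefect_of_kim2025_OPEN_of_casselsTate W p hK25s hCT
      hGZK hmod hp3 hr htower D hper
  have hqq : q'' = q' := by exact_mod_cast hq''.symm.trans hq'
  subst hqq
  rw [missingUpperBoundAt_iff_kimTamagawaDefectGeAt_of_kim2025_OPEN W p hK25s hGZK hmod hp3 hr htower
    D hper hint, X4.KimTamagawaDefectGeAt, hd, ENat.coe_le_coe]
  rw [hd] at hge
  have hge' : (padicValNat p W.tamagawaProduct : ℤ) ≤ d + 1 := by exact_mod_cast hge
  have hev' : Even ((padicValNat p W.tamagawaProduct : ℤ) - d) := by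
    obtain ⟨k, hk⟩ := heven
    obtain ⟨m, hm⟩ := hev
    exact ⟨k - m, by omega⟩
  exact_mod_cast Int.le_of_le_add_one_of_even_sub' hge' hev'

/-- **LOWER half from the `≤` half relaxed by one, even tower row, `p ≥ 3`, CONDITIONAL on the
preprint**: `#Ш_an = q'`, `ord_p q'` even, `∂^{(∞)}(δ̃) ≤ ord_p ∏_v c_v + 1` ⟹
`Typed.MissingLowerBoundAt W p`. [claim: Kim2025RefinedTNC, status: under-review]
[cite: Kim2025RefinedTNC, Thm. 1.1 ("BSD") (ANNOUNCED, OPEN binder)] [cite: SilvermanAEC2009, Thm. X.4.14]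
[cite: Miller2011LMS, Def. 1.1] -/
theorem missingLowerBoundAt_of_kimDefect_le_tamagawa_add_one_of_even_of_kim2025_OPEN
    (hK25s : Kim2025.thm11_kimShaLength_of_integralPeriod_OPEN)
    (hCT : exists_casselsTate_pairing (K := ℚ))
    (hGZK : rank_eq_analyticRank_of_analyticRank_le_one) (hmod : hasEntireLFunction_rat)
    (hp3 : 3 ≤ p) (hr : W.analyticRank = 0) (htower : ∀ n : ℕ, W.HasSurjectiveModNGaloisRep (p ^ n : ℕ))
    {N : ℕ} [NeZero N] (D : ModularParametrizationData W N)
    (hper : ∃ u : ℚ, ‖(u : ℚ_[p])‖ = 1 ∧ W.realPeriodRat = u * plusPeriod D.f)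
    {q' : ℚ} (hq' : shaAn W = (q' : ℂ)) (hev : Even (padicValRat p q'))
    (hle : kuriharaPartialInfty W p D.f ≤ (padicValNat p W.tamagawaProduct + 1 : ℕ)) :
    MissingLowerBoundAt W p := by
  have hp2 : p ≠ 2 := by omega
  have hint := forall_padicValRat_ratPlusSymbol_nonneg_of_towerSurj hp2 D.isNewformOf htower
  obtain ⟨q'', d, hq'', hd, heven⟩ :=
    even_padicValRat_shaAn_add_tamagawa_sub_kimDefect_of_kim2025_OPEN_of_casselsTate W p hK25s hCT
      hGZK hmod hp3 hr htower D hper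
  have hqq : q'' = q' := by exact_mod_cast hq''.symm.trans hq'
  subst hqq
  rw [missingLowerBoundAt_iff_kimTamagawaDefectLeAt_of_kim2025_OPEN W p hK25s hGZK hmod hp3 hr htower
    D hper hint, X4.KimTamagawaDefectLeAt, hd, ENat.coe_le_coe]
  rw [hd] at hle
  have hle' : (d : ℤ) ≤ padicValNat p W.tamagawaProduct + 1 := by exact_mod_cast hle
  have hev' : Even ((d : ℤ) - padicValNat p W.tamagawaProduct) := by
    obtain ⟨k, hk⟩ := heven
    obtain ⟨m, hm⟩ := hev
    exact ⟨m - k, by omega⟩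
  exact_mod_cast Int.le_of_le_add_one_of_even_sub' hle' hev'

/-- **The `p`-part from Conjecture 1.10 WITHIN ONE, even tower row, `p ≥ 3`, CONDITIONAL on the
preprint**: both one-off inequalities ⟹ `Typed.MissingPPartAt W p` (hence `BSD(E,p)`).
[claim: Kim2025RefinedTNC, status: under-review]
[cite: Kim2025RefinedTNC, Thm. 1.1 ("BSD") (ANNOUNCED, OPEN binder)] [cite: Miller2011LMS, §1 and Def. 1.1] -/
theorem missingPPartAt_of_kimDefect_within_one_of_even_of_kim2025_OPEN
    (hK25s : Kim2025.thm11_kimShaLength_of_integralPeriod_OPEN)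
    (hCT : exists_casselsTate_pairing (K := ℚ))
    (hGZK : rank_eq_analyticRank_of_analyticRank_le_one) (hmod : hasEntireLFunction_rat)
    (hp3 : 3 ≤ p) (hr : W.analyticRank = 0) (htower : ∀ n : ℕ, W.HasSurjectiveModNGaloisRep (p ^ n : ℕ))
    {N : ℕ} [NeZero N] (D : ModularParametrizationData W N)
    (hper : ∃ u : ℚ, ‖(u : ℚ_[p])‖ = 1 ∧ W.realPeriodRat = u * plusPeriod D.f)
    {q' : ℚ} (hq' : shaAn W = (q' : ℂ)) (hev : Even (padicValRat p q'))
    (hge : (padicValNat p W.tamagawaProduct : ℕ∞) ≤ kuriharaPartialInfty W p D.f + 1)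
    (hle : kuriharaPartialInfty W p D.f ≤ (padicValNat p W.tamagawaProduct + 1 : ℕ)) :
    MissingPPartAt W p :=
  missingPPartAt_of_lower_of_upper W p
    (missingLowerBoundAt_of_kimDefect_le_tamagawa_add_one_of_even_of_kim2025_OPEN W p hK25s hCT hGZK
      hmod hp3 hr htower D hper hq' hev hle)
    (missingUpperBoundAt_of_tamagawa_le_kimDefect_add_one_of_even_of_kim2025_OPEN W p hK25s hCT hGZK
      hmod hp3 hr htower D hper hq' hev hge)

/-! ### §3 The ONE-FACTOR socket and the `ord_p ∏c ≤ 2` dichotomy on unit tower rows -/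

/-- **THE ONE-FACTOR SOCKET at `p ≥ 3` on a unit tower row, CONDITIONAL on the preprint**:
`#Ш_an = q'` a `p`-unit, some `α ≤ ∂^{(∞)}(δ̃_{D.f})` with **`ord_p ∏_v c_v ≤ α + 1`** ⟹ `BSD(E,p)`.
At `p = 3` the N11 TAM-DEFECT₂♭ unit rows with `ord₃ ∏_v c_v = 2` close on the input `α = 1`, i.e.
"EVERY cyclic-level Kurihara number is divisible by `3`" — half of what Conjecture 1.10 predicts.
[claim: Kim2025RefinedTNC, status: under-review]
[cite: Kim2025RefinedTNC, Thm. 1.1 ("BSD") (ANNOUNCED, OPEN binder)] [cite: SilvermanAEC2009, Thm. X.4.14]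
[cite: Kim2022StructureSelmer, Conj. 1.10 (PDF p. 8)] [cite: Miller2011LMS, §1 and Def. 1.1] -/
theorem bsdp_of_le_kimDefect_of_tamagawa_le_add_one_of_shaAn_unit_of_kim2025_OPEN
    (hK25s : Kim2025.thm11_kimShaLength_of_integralPeriod_OPEN)
    (hCT : exists_casselsTate_pairing (K := ℚ))
    (hGZK : rank_eq_analyticRank_of_analyticRank_le_one) (hmod : hasEntireLFunction_rat)
    (hp3 : 3 ≤ p) (hr : W.analyticRank = 0) (htower : ∀ n : ℕ, W.HasSurjectiveModNGaloisRep (p ^ n : ℕ))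
    {N : ℕ} [NeZero N] (D : ModularParametrizationData W N)
    (hper : ∃ u : ℚ, ‖(u : ℚ_[p])‖ = 1 ∧ W.realPeriodRat = u * plusPeriod D.f)
    {q' : ℚ} (hq' : shaAn W = (q' : ℂ)) (hv : padicValRat p q' = 0)
    {α : ℕ} (hα : (α : ℕ∞) ≤ kuriharaPartialInfty W p D.f)
    (htam : padicValNat p W.tamagawaProduct ≤ α + 1) : BSDp W p := by
  have hev : Even (padicValRat p q') := by rw [hv]; exact ⟨0, rfl⟩
  have hge : (padicValNat p W.tamagawaProduct : ℕ∞) ≤ kuriharaPartialInfty W p D.f + 1 := by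
    calc (padicValNat p W.tamagawaProduct : ℕ∞) ≤ ((α + 1 : ℕ) : ℕ∞) := by exact_mod_cast htam
      _ = (α : ℕ∞) + 1 := by push_cast; rfl
      _ ≤ kuriharaPartialInfty W p D.f + 1 := add_le_add hα le_rfl
  have hup := missingUpperBoundAt_of_tamagawa_le_kimDefect_add_one_of_even_of_kim2025_OPEN W p hK25s
    hCT hGZK hmod hp3 hr htower D hper hq' hev hge
  have hlow : MissingLowerBoundAt W p := ⟨q', hq', by rw [hv]; exact_mod_cast Nat.zero_le _⟩
  exact bsdp_of_missingPPartAt W p hGZK (by rw [hr]; exact zero_le_one)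
    (missingPPartAt_of_lower_of_upper W p hlow hup)

/-- **THE `ord_p ∏c ≤ 2` DICHOTOMY on a unit tower row, `p ≥ 3`, CONDITIONAL on the preprint**: if
`p ∤ #Ш_an` and `1 ≤ ord_p ∏_v c_v ≤ 2` (the Tamagawa-defect-one rows and the bulk of TAM-DEFECT₂♭),
then **`BSD(E,p) ⟺ 1 ≤ ∂^{(∞)}(δ̃_{D.f})`** — i.e. iff NO cyclic-level Kurihara number of `D.f` is a
`p`-adic unit. (`→`: `BSD(E,p)` gives Conjecture 1.10 at the pair, `∂^{(∞)} = ord_p ∏c ≥ 1`;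
`←`: the socket with `α = 1`.) So on these rows a unit Kurihara number found by the census REFUTES
`BSD(E,3)` modulo the preprint (anomaly protocol), and its absence at all levels is exactly what is
missing. [claim: Kim2025RefinedTNC, status: under-review]
[cite: Kim2025RefinedTNC, Thm. 1.1 ("BSD") (ANNOUNCED, OPEN binder)] [cite: SilvermanAEC2009, Thm. X.4.14]
[cite: Kim2022StructureSelmer, Conj. 1.10 (PDF p. 8)] [cite: Miller2011LMS, §1 and Def. 1.1] -/
theorem bsdp_iff_one_le_kimDefect_of_tamagawa_le_two_of_shaAn_unit_of_kim2025_OPEN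
    (hK25s : Kim2025.thm11_kimShaLength_of_integralPeriod_OPEN)
    (hCT : exists_casselsTate_pairing (K := ℚ))
    (hGZK : rank_eq_analyticRank_of_analyticRank_le_one) (hmod : hasEntireLFunction_rat)
    (hp3 : 3 ≤ p) (hr : W.analyticRank = 0) (htower : ∀ n : ℕ, W.HasSurjectiveModNGaloisRep (p ^ n : ℕ))
    {N : ℕ} [NeZero N] (D : ModularParametrizationData W N)
    (hper : ∃ u : ℚ, ‖(u : ℚ_[p])‖ = 1 ∧ W.realPeriodRat = u * plusPeriod D.f)
    {q' : ℚ} (hq' : shaAn W = (q' : ℂ)) (hv : padicValRat p q' = 0)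
    (hc1 : 1 ≤ padicValNat p W.tamagawaProduct) (hc2 : padicValNat p W.tamagawaProduct ≤ 2) :
    BSDp W p ↔ (1 : ℕ∞) ≤ kuriharaPartialInfty W p D.f := by
  have hp2 : p ≠ 2 := by omega
  have hint := forall_padicValRat_ratPlusSymbol_nonneg_of_towerSurj hp2 D.isNewformOf htower
  constructor
  · intro h
    have hK : X4.KimTamagawaDefectAt W p D.f :=
      (bsdp_iff_kimTamagawaDefectAt_of_kim2025_OPEN W p hK25s hGZK hmod hp3 hr htower D hper hint).mp h
    rw [X4.KimTamagawaDefectAt] at hK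
    rw [hK]
    exact_mod_cast hc1
  · intro h1
    exact bsdp_of_le_kimDefect_of_tamagawa_le_add_one_of_shaAn_unit_of_kim2025_OPEN W p hK25s hCT hGZK
      hmod hp3 hr htower D hper hq' hv (α := 1) (by exact_mod_cast h1) (by omega)

/-! ### §4 OPTIMAL data at `p ≥ 3` (period transfer by optimality, `p ∤ c`) -/

/-- **The parity law on an OPTIMAL datum at `p ≥ 3`, tower row, CONDITIONAL on the preprint**
(`Λ_E = c·Λ_f`, `p ∤ c`: period transfer by `X4.periodTransfer_of_optimal`): `#Ш_an = q'`,
`∂^{(∞)}(δ̃) = d`, `ord_p q' + ord_p ∏_v c_v − d` even. The census form for Cremona's optimal curves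
at `3` (one `3 ∤ c` bit; tower from a `j`-witness / I₀* / surj(9) certificate upstream).
[claim: Kim2025RefinedTNC, status: under-review]
[cite: Kim2025RefinedTNC, Thm. 1.1 ("BSD") (ANNOUNCED, OPEN binder)] [cite: SilvermanAEC2009, Thm. X.4.14]
[cite: CremonaAlgorithms1997, §2.8 (p. 26)] -/
theorem even_padicValRat_shaAn_add_tamagawa_sub_kimDefect_of_optimal_of_kim2025_OPEN
    (hK25s : Kim2025.thm11_kimShaLength_of_integralPeriod_OPEN)
    (hCT : exists_casselsTate_pairing (K := ℚ))
    (hGZK : rank_eq_analyticRank_of_analyticRank_le_one) (hmod : hasEntireLFunction_rat)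
    (hp3 : 3 ≤ p) (hr : W.analyticRank = 0) (htower : ∀ n : ℕ, W.HasSurjectiveModNGaloisRep (p ^ n : ℕ))
    {N : ℕ} [NeZero N] (D : ModularParametrizationData W N)
    (hopt : ∀ z ∈ D.L.lattice, ∃ w ∈ periodLattice D.f, z = D.c * w)
    (hc : ¬ (p : ℤ) ∣ D.maninConstant) :
    ∃ (q' : ℚ) (d : ℕ), shaAn W = (q' : ℂ) ∧ kuriharaPartialInfty W p D.f = d ∧
      Even (padicValRat p q' + padicValNat p W.tamagawaProduct - d) :=
  even_padicValRat_shaAn_add_tamagawa_sub_kimDefect_of_kim2025_OPEN_of_casselsTate W p hK25s hCT hGZK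
    hmod hp3 hr htower D (X4.periodTransfer_of_optimal p D hopt hc)

/-- **The `ord_p ∏c ≤ 2` dichotomy on an OPTIMAL datum, unit tower row, `p ≥ 3`, CONDITIONAL on
the preprint**: `BSD(E,p) ⟺ 1 ≤ ∂^{(∞)}(δ̃_{D.f})`. [claim: Kim2025RefinedTNC, status: under-review]
[cite: Kim2025RefinedTNC, Thm. 1.1 ("BSD") (ANNOUNCED, OPEN binder)] [cite: Miller2011LMS, §1 and Def. 1.1]
[cite: CremonaAlgorithms1997, §2.8 (p. 26)] -/
theorem bsdp_iff_one_le_kimDefect_of_tamagawa_le_two_of_shaAn_unit_of_optimal_of_kim2025_OPEN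
    (hK25s : Kim2025.thm11_kimShaLength_of_integralPeriod_OPEN)
    (hCT : exists_casselsTate_pairing (K := ℚ))
    (hGZK : rank_eq_analyticRank_of_analyticRank_le_one) (hmod : hasEntireLFunction_rat)
    (hp3 : 3 ≤ p) (hr : W.analyticRank = 0) (htower : ∀ n : ℕ, W.HasSurjectiveModNGaloisRep (p ^ n : ℕ))
    {N : ℕ} [NeZero N] (D : ModularParametrizationData W N)
    (hopt : ∀ z ∈ D.L.lattice, ∃ w ∈ periodLattice D.f, z = D.c * w)
    (hc : ¬ (p : ℤ) ∣ D.maninConstant)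
    {q' : ℚ} (hq' : shaAn W = (q' : ℂ)) (hv : padicValRat p q' = 0)
    (hc1 : 1 ≤ padicValNat p W.tamagawaProduct) (hc2 : padicValNat p W.tamagawaProduct ≤ 2) :
    BSDp W p ↔ (1 : ℕ∞) ≤ kuriharaPartialInfty W p D.f :=
  bsdp_iff_one_le_kimDefect_of_tamagawa_le_two_of_shaAn_unit_of_kim2025_OPEN W p hK25s hCT hGZK hmod
    hp3 hr htower D (X4.periodTransfer_of_optimal p D hopt hc) hq' hv hc1 hc2

end PerPair

end Summit.BirchSwinnertonDyer.Rank1Residual.Additive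

end
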